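import Literature.NumberTheory.Automorphic.LanglandsTunnellCases
import Literature.NumberTheory.Automorphic.LanglandsTunnellLSeriesProofs
import Literature.NumberTheory.Automorphic.GodementJacquetPartialL
import Literature.NumberTheory.Automorphic.AutomorphicLFunctionSplittingProofs
import Literature.NumberTheory.GaloisRepresentations.ArtinLFunctionContinuationFE
import Literature.NumberTheory.GaloisRepresentations.ArtinLFunctionNonvanishingProofs
import Literature.NumberTheory.GaloisRepresentations.ArtinEulerProductProofs
import Literature.NumberTheory.GaloisRepresentations.FramedRepDualProofs
import HarnessLib

/-!
# Tunnell's bridge "`π = π(ρ)` ⇒ `L(s, ρ)` entire" from its two printed inputs (proofs)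
(companion to `Literature.NumberTheory.Automorphic.LanglandsTunnellCases`)

The named fact `Literature.NumberTheory.Automorphic.hasEntireContinuation_artinLFunction_of_isPiOfArtinRep`
(`Automorphic/LanglandsTunnellCases`; Tunnell, Bull. AMS 5 (1981), p. 173: "When `π = π(ρ)` the
L-series of `π` and `ρ` agree, and since cuspidal representations have entire L-series, Artin's
conjecture follows") says: for a number field `F`, an irreducible continuous
`σ : Γ_F → GL_2(ℂ)`, a cuspidal automorphic representation `π` of `GL_2(𝔸_F)`
(`CuspidalAutomorphicRepData 2 F hcpt`) with `π = π(σ)` in Tunnell's almost-everywhere sense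
(`IsPiOfArtinRep σ π.1`: Frobenius–Satake compatibility at all but finitely many finite places),
`L(s, σ)` (`artinLFunction`) has entire continuation.  Over the tree's honest carriers this is
the conjunction of two theorems in print, each a theory of its own:

* (JL) **cuspidal representations of `GL(2)` have entire L-series** — Jacquet–Langlands,
  LNM 114 (1970), §11 (Thm. 11.1: for a constituent `π` of the space of cusp forms, `L(s, π)`
  and `L(s, π̃)` are entire); in the exposition of Gelbart, *Automorphic forms on adele groups*
  (1975), Thm. 6.18 (i) ("`L(s, χ ⊗ π)` extends to an entire function bounded in vertical
  strips" for `π` in `R_0^ψ`, with the functional equation (6.44) relating `π` and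
  `π̃ = ψ⁻¹ ⊗ π`), (6.43) (`L(s, π) = ∏_v L(s, π_v)` converges for `re s` large), Thms. 6.15,
  6.16 (the local factors: at a class-one place `L(s, π_v) = (1 - μ_v(ϖ) q^{-s})⁻¹
  (1 - ν_v(ϖ) q^{-s})⁻¹`, in general the inverse of a polynomial in `q^{-s}`, resp. a product
  of `Γ`-functions at the archimedean places — so the *partial* L-function
  `L^S(s, π) = L(s, π) ∏_{v ∈ S ∪ S_∞} L(s, π_v)⁻¹` is entire with `L(s, π)`); Bump,
  *Automorphic forms and representations* (1997), §3.5, (5.22)–(5.24) (the partial L-function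
  `L_S(s, π) = ∏_{v ∉ S} (1 - α_{1,v} q_v^{-s})⁻¹ (1 - α_{2,v} q_v^{-s})⁻¹` in terms of the
  Satake parameters; reduction to unitary central character by twisting) and Thm. 3.5.6 (its
  functional equation against `L_S(1 - s, π̂)`, the Satake parameters of the contragredient
  `π̂_v` being `α_{i,v}⁻¹`).  In the tree's vocabulary (no local representation `π_v`, hence no
  ramified local factor, is available) this is the statement that for every Satake family `α` of
  `π` off a finite set `S` (`π.1.HasSatakeParamAt v (α v)`, `v ∉ S`) the partial Euler products
  `L^S(s, α) = partialStandardL ↑S α s` and `L^S(s, α⁻¹)` (`dualFamily α`) continue to entire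
  functions from some right half-plane.  It is **not** restated as a named fact here (D-0026);
  it enters the theorems below as the hypothesis `hJL`, written out in full.
* (FE) **Artin's functional equation** `Λ(1 - s, σ) = W Λ(s, σ^∨)` (Artin 1931, Brauer 1947;
  Neukirch VII (12.6)) — the named fact `Literature.NumberTheory.Automorphic.artin_functional_equation`
  of `Automorphic/ArtinLFunctions`, threaded as the hypothesis `hFE`.

**Main result (proved):** `hasEntireContinuation_artinLFunction_of_isPiOfArtinRep_of` —
(FE) for every number field and (JL) imply the bridge.  Proof ("the L-series of `π` and `ρ`
agree", made exact): let `S` be the finite exceptional set of `IsPiOfArtinRep σ π.1` and `α v`,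
`v ∉ S`, the compatible Satake parameters.  At `v ∉ S`, `σ` is unramified with
`charpoly σ(Frob_v) = ∏_{a ∈ α v} (X - a)`, so the Artin Euler factor
`det(1 - T σ(Frob_v) | V^{I_v} = V)` is `∏_{a ∈ α v} (1 - a T)`
(`eulerFactorAt_eq_eulerPolynomial_of_hasFrobCharpolyAt`), the `a ∈ α v` are roots of unity
(eigenvalues of a finite-order matrix, `norm_eq_one_of_mem_of_hasFrobCharpolyAt`), and the
contragredient `σ^∨ = (σᵀ)⁻¹` has Euler factor `∏_{a ∈ α v} (1 - a⁻¹ T)` there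
(`dual_eulerFactorAt_eq_eulerPolynomial_of_hasFrobCharpolyAt`).  Hence on `re s > 1`
`L(s, σ) = (∏_{v ∈ S} L_v(σ, q_v^{-s})⁻¹) · L^S(s, α)` (the tree's Euler product is
multipliable there, `multipliable_artinLFunction_holds`, and splits off the finite set `S`,
`prod_mul_tprod_compl_of_multipliable`), the entire function `g` of (JL) agrees with
`L^S(s, α)` on all of `re s > 1` (identity principle; `L^S(s, α)` is holomorphic there by the
`M`-test, `differentiableOn_partialStandardL_of_norm_le_one`), and the finitely many removed
factors `L_v(σ, q_v^{-s}) = ∏ (1 - μ q_v^{-s})`, `|μ| = 1`, do not vanish on `re s > 0`; so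
`L(s, σ)` continues holomorphically to `re s > 0`
(`exists_differentiableOn_re_pos_of_entire_partialL`), and likewise `L(s, σ^∨)` through
`L^S(s, α⁻¹)`.  Artin's functional equation then gives entirety by the tree's device
`ArtinRep.hasEntireContinuation_of_satisfiesFunctionalEquation`
(`GaloisRepresentations/ArtinLFunctionContinuationFE`; Deligne–Serre 1974, proof of Thm. 4.6,
plays the two functional equations against the finitely many factors in the same way).  No local
comparison at the ramified places (Jacquet–Langlands §12; Gelbart 1997, Prop. 4.1) is needed,
and the irreducibility hypothesis of the bridge is not used.

Consequences (proved): the three cases and the assembly of `LanglandsTunnellCases` with the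
bridge replaced by (FE) + (JL) (`hasEntireContinuation_artinLFunction_of_isSolvable_of_cases_of_FE_of_JL`,
`langlands_tunnell_hasEntireContinuation_of_cases_of_FE_of_JL`).

So `hasEntireContinuation_artinLFunction_of_isPiOfArtinRep_holds` is this file's main theorem
applied to `artin_functional_equation_holds` (Brauer induction, Hecke L-functions, class field
theory) and to the global Hecke theory of `GL(2)` (Jacquet–Langlands §§9–11: Whittaker models,
the Fourier expansion of cusp forms, the local functional equations at every place), neither of
which is in Mathlib or in the tree.

## Mathlib / Literature search

Everything automorphic or Galois-theoretic is the tree's (`lean search`): `IsPiOfArtinRep`,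
`FrobSatakeCompatibleAt`, `CuspidalAutomorphicRepData`, `HasSatakeParamAt` (`StrongArtinGL2`,
`AutomorphicRepsGL`), `SatakeFamily`, `partialStandardL`, `eulerPolynomial`, `dualFamily`
(`AutomorphicLFunction`), `satakePolynomial` (`SatakeParametersGL`), `ArtinRep.eulerFactorAt`,
`artinLFunction`, `FramedRep.dual` (`GaloisRepresentations`); the reused proved inputs are named
in the docstrings.  Mathlib supplies the identity principle
(`AnalyticOnNhd.eqOn_of_preconnected_of_eventuallyEq`), `DifferentiableOn.analyticOnNhd`,
`convex_halfSpace_re_gt`, `Filter.eventually_cofinite`.  No definition and no named fact is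
introduced; nothing restates an existing declaration.

## References

* J. Tunnell, *Artin's conjecture for representations of octahedral type*, Bull. AMS (N.S.) 5
  (1981), 173–175: p. 173, second paragraph. [Tunnell1981]
* H. Jacquet, R. P. Langlands, *Automorphic Forms on GL(2)*, LNM 114 (1970), §11 (Thm. 11.1),
  §12. [JacquetLanglands1970]
* S. Gelbart, *Automorphic Forms on Adele Groups*, Ann. of Math. Studies 83 (1975), §6:
  Thms. 6.15, 6.16, (6.43), Thm. 6.18. [Gelbart1975]
* D. Bump, *Automorphic Forms and Representations* (1997), §3.5: (5.22)–(5.24), Prop. 3.5.3,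
  Thm. 3.5.6. [Bump1997]
* J. Neukirch, *Algebraic Number Theory* (1999), VII §10 (10.1), §12 Thm. (12.6). [NeukirchANT1999]
* P. Deligne, J.-P. Serre, *Formes modulaires de poids 1*, Ann. Sci. ÉNS (4) 7 (1974), proof of
  Thm. 4.6. [DeligneSerreASENS1974]
-/

noncomputable section

open scoped MatrixGroups NumberField Polynomial
open NumberField IsDedekindDomain Field Polynomial Complex Filter Topology
open Literature.NumberTheory.GaloisRepresentations (ArtinRep FramedArtinRep)

namespace Literature.NumberTheory.Automorphic

/-! ### Polynomial bookkeeping: Satake polynomial vs. Euler polynomial -/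

/-- `reverse (∏_{a ∈ α} (X - a)) = ∏_{a ∈ α} (1 - a X)`: the passage from the characteristic
polynomial `det(X - F)` of a Frobenius to the Euler polynomial `det(1 - T F)`
(`satakePolynomial`, `eulerPolynomial`). [folklore] -/
theorem reverse_satakePolynomial (α : Multiset ℂ) :
    (satakePolynomial α).reverse = eulerPolynomial α := by
  unfold satakePolynomial eulerPolynomial
  induction α using Multiset.induction_on with
  | empty => simpa using reverse_C (1 : ℂ)
  | cons a α ih =>
    rw [Multiset.map_cons, Multiset.prod_cons, reverse_mul_of_domain, ih, reverse_X_sub_C',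
      Multiset.map_cons, Multiset.prod_cons]

/-- `(∏_{a ∈ α} (X - a))‾ = ∏_{a ∈ α} (X - ā)` (complex conjugation of coefficients). [folklore] -/
theorem map_conj_satakePolynomial (α : Multiset ℂ) :
    (satakePolynomial α).map (starRingEnd ℂ) = satakePolynomial (α.map (starRingEnd ℂ)) := by
  unfold satakePolynomial
  rw [Polynomial.map_multiset_prod, Multiset.map_map, Multiset.map_map]
  congr 1
  refine Multiset.map_congr rfl fun a _ => ?_
  simp [Polynomial.map_sub]

/-! ### Galois side: Euler factors at the compatible places -/

section GaloisSide

variable {F : Type} [Field F] [NumberField F] {n : ℕ}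

/-- A continuous `σ : Γ_F → GL_n(ℂ)` has finite image (`ArtinRep.finite_range_holds`, Serre,
*Abelian ℓ-adic representations* (1968), Ch. I §1.1, Remark; transported to `GL_n(ℂ)` by
`FramedRep.finite_range_toContinuousRep_iff`). [cite: SerreAbelianLadic1968, Ch. I §1.1 Remark] -/
theorem finite_range_framedArtinRep (σ : FramedArtinRep F n) :
    (Set.range (σ : absoluteGaloisGroup F → GL (Fin n) ℂ)).Finite :=
  (GaloisRepresentations.FramedRep.finite_range_toContinuousRep_iff σ).mp
    (GaloisRepresentations.ArtinRep.finite_range_holds (K := F) (V := Fin n → ℂ) σ.toArtinRep)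

/-- **The Artin Euler factor at an unramified place with known Frobenius.**  If `σ` is
unramified at `v` and every arithmetic Frobenius at `v` has characteristic polynomial
`∏_{a ∈ α} (X - a)`, then `L_v(σ, T) = det(1 - T σ(Frob) | V^{I_v}) = ∏_{a ∈ α} (1 - a T)`
(`V^{I_v} = V`, `ArtinRep.eulerPolynomial_eq_reverse_charpoly`; the pair `(𝔓, Frob_𝔓)` chosen in
`eulerFactorAt` exists, `ArtinRep.eulerFactorAt_eq_of_forall_eulerPolynomial_eq`).  This is "the
L-series of `π` and `ρ` agree" at a place where `π_v = π(ρ_v)` is unramified (Tunnell 1981,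
p. 173; Neukirch VII §10, (10.1)). [cite: NeukirchANT1999, VII §10, (10.1)] -/
theorem eulerFactorAt_eq_eulerPolynomial_of_hasFrobCharpolyAt (σ : FramedArtinRep F n)
    {v : HeightOneSpectrum (𝓞 F)} (hur : σ.IsUnramifiedAt v) {α : Multiset ℂ}
    (hchar : σ.HasFrobCharpolyAt v (satakePolynomial α)) :
    σ.toArtinRep.eulerFactorAt v = eulerPolynomial α := by
  rw [← GaloisRepresentations.FramedGaloisRep.isUnramifiedAt_toGaloisRep_iff] at hur
  rw [← GaloisRepresentations.FramedGaloisRep.hasFrobCharpolyAt_toGaloisRep_iff] at hchar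
  refine GaloisRepresentations.ArtinRep.eulerFactorAt_eq_of_forall_eulerPolynomial_eq _
    fun {𝔓} h𝔓 {τ} hτ => ?_
  rw [GaloisRepresentations.ArtinRep.eulerPolynomial_eq_reverse_charpoly _ (hur _ h𝔓)]
  change (σ.toGaloisRep τ).charpoly.reverse = _
  rw [hchar _ h𝔓 τ hτ, reverse_satakePolynomial]

/-- **Frobenius eigenvalues are roots of unity.**  If every arithmetic Frobenius at `v` has
characteristic polynomial `∏_{a ∈ α} (X - a)` on `σ`, then `|a| = 1` for `a ∈ α`: the image of
`σ` is finite, so `σ(Frob)` has finite order (`FramedRep.exists_coe_pow_eq_one`,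
`Matrix.norm_eq_one_of_mem_roots_charpoly_of_pow_eq_one`).
Ref: Neukirch VII §10, remark after (10.1) ("the `εᵢ` … are roots of unity"). [folklore] -/
theorem norm_eq_one_of_mem_of_hasFrobCharpolyAt (σ : FramedArtinRep F n)
    {v : HeightOneSpectrum (𝓞 F)} {α : Multiset ℂ}
    (hchar : σ.HasFrobCharpolyAt v (satakePolynomial α)) {a : ℂ} (ha : a ∈ α) : ‖a‖ = 1 := by
  obtain ⟨𝔓, h𝔓⟩ := HeightOneSpectrum.primesAbove_nonempty v
  obtain ⟨φ, hφ⟩ := HeightOneSpectrum.exists_isArithFrobAt_of_mem_primesAbove_holds h𝔓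
  obtain ⟨m, hm, hpow⟩ := GaloisRepresentations.FramedRep.exists_coe_pow_eq_one σ
    (finite_range_framedArtinRep σ) φ
  have hch : ((σ φ : GL (Fin n) ℂ) : Matrix (Fin n) (Fin n) ℂ).charpoly = satakePolynomial α :=
    hchar 𝔓 h𝔓 φ hφ
  refine Matrix.norm_eq_one_of_mem_roots_charpoly_of_pow_eq_one hm hpow ?_
  rw [hch, roots_satakePolynomial]
  exact ha

/-- **The Euler factor of the contragredient at a compatible place.**  If `σ : Γ_F → GL_2(ℂ)`
is unramified at `v` with `charpoly σ(Frob_v) = ∏_{a ∈ α} (X - a)`, then `σ^∨ = (σᵀ)⁻¹`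
(`FramedRep.dual`) is unramified at `v` with Euler factor `∏_{a ∈ α} (1 - a⁻¹ T)`: its Frobenius
has characteristic polynomial `∏ (X - ā)` (`FramedGaloisRep.hasFrobCharpolyAt_dual`) and
`ā = a⁻¹` for the roots of unity `a`.  These are the Euler factors of `L^S(s, π̃)`, the Satake
parameters of `π̃_v = π_v^∨` being the inverses of those of `π_v` (Bump 1997, §3.5, proof of
Thm. 3.5.6). [cite: Bump1997, §3.5, Thm. 3.5.6] -/
theorem dual_eulerFactorAt_eq_eulerPolynomial_of_hasFrobCharpolyAt (σ : FramedArtinRep F 2)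
    {v : HeightOneSpectrum (𝓞 F)} (hur : σ.IsUnramifiedAt v) {α : Multiset ℂ}
    (hchar : σ.HasFrobCharpolyAt v (satakePolynomial α)) :
    (FramedArtinRep.toArtinRep (GaloisRepresentations.FramedRep.dual σ)).eulerFactorAt v =
      eulerPolynomial (α.map (·⁻¹)) := by
  have hur' := GaloisRepresentations.FramedGaloisRep.isUnramifiedAt_dual hur
  have hchar' := GaloisRepresentations.FramedGaloisRep.hasFrobCharpolyAt_dual
    (finite_range_framedArtinRep σ) hchar
  rw [map_conj_satakePolynomial] at hchar'
  have hconj : α.map (starRingEnd ℂ) = α.map (·⁻¹) :=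
    Multiset.map_congr rfl fun a ha =>
      (Complex.inv_eq_conj (norm_eq_one_of_mem_of_hasFrobCharpolyAt σ hchar ha)).symm
  rw [hconj] at hchar'
  exact eulerFactorAt_eq_eulerPolynomial_of_hasFrobCharpolyAt _ hur' hchar'

end GaloisSide

/-! ### Analytic glue: continuation to `re s > 0` from an entire partial Euler product -/

section AnalyticGlue

variable {K : Type} [Field K] [NumberField K]

/-- **An identity principle on right half-planes.**  Two functions holomorphic on `re s > c`
which agree on some half-plane `re s > x₀` agree on all of `re s > c` (the half-plane is
connected; Mathlib `AnalyticOnNhd.eqOn_of_preconnected_of_eventuallyEq`). [folklore] -/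
theorem eqOn_halfPlane_of_eqOn_far_right {f g : ℂ → ℂ} {c x₀ : ℝ}
    (hf : DifferentiableOn ℂ f {s : ℂ | c < s.re}) (hg : DifferentiableOn ℂ g {s : ℂ | c < s.re})
    (h : ∀ s : ℂ, x₀ < s.re → f s = g s) : ∀ s : ℂ, c < s.re → f s = g s := by
  have hU : IsOpen {s : ℂ | c < s.re} := isOpen_lt continuous_const continuous_re
  have hpre : IsPreconnected {s : ℂ | c < s.re} := (convex_halfSpace_re_gt c).isPreconnected
  set z₀ : ℂ := ((max c x₀ + 1 : ℝ) : ℂ) with hz₀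
  have hz₀re : z₀.re = max c x₀ + 1 := by rw [hz₀, ofReal_re]
  have hz₀U : z₀ ∈ {s : ℂ | c < s.re} := by
    show c < z₀.re
    rw [hz₀re]
    exact (le_max_left _ _).trans_lt (lt_add_one _)
  have hev : f =ᶠ[𝓝 z₀] g := by
    have hO : IsOpen {s : ℂ | max c x₀ < s.re} := isOpen_lt continuous_const continuous_re
    have hz₀O : z₀ ∈ {s : ℂ | max c x₀ < s.re} := by
      show max c x₀ < z₀.re
      rw [hz₀re]
      exact lt_add_one _
    filter_upwards [hO.mem_nhds hz₀O] with s hs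
    exact h s ((le_max_right _ _).trans_lt hs)
  intro s hs
  exact (hf.analyticOnNhd hU).eqOn_of_preconnected_of_eventuallyEq (hg.analyticOnNhd hU) hpre
    hz₀U hev hs

/-- **The partial Euler product of a unit Satake family is holomorphic on `re s > 1`.**  If
`|a| ≤ 1` for all `a ∈ β v`, `v ∉ S`, and `card (β v) ≤ d`, then
`L^S(s, β) = ∏'_{v ∉ S} ∏_{a ∈ β v} (1 - a q_v^{-s})⁻¹` (`partialStandardL`) is holomorphic on
`re s > 1`: on `re s > σ₁ > 1`, `‖∏_{a}(1 - a q_v^{-s}) - 1‖ ≤ (2^d - 1) q_v^{-σ₁}`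
(`norm_eval_eulerPolynomial_sub_one_le`), summable over `v` (`summable_residueCard_rpow_neg`), and
no factor vanishes (`|a q_v^{-s}| < 1`), so the `M`-test applies
(`differentiableOn_partialStandardL_of_norm_sub_one_le`).  This is the convergence of the Artin
Euler product "in the same way as for the Hecke L-series" (Neukirch VII §10, remark after
(10.1)). [cite: NeukirchANT1999, VII §10, remark after (10.1)] -/
theorem differentiableOn_partialStandardL_of_norm_le_one {S : Set (HeightOneSpectrum (𝓞 K))}
    {β : SatakeFamily K} {d : ℕ} (hβ1 : ∀ v ∉ S, ∀ a ∈ β v, ‖a‖ ≤ 1)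
    (hd : ∀ v ∉ S, Multiset.card (β v) ≤ d) :
    DifferentiableOn ℂ (partialStandardL S β) {s : ℂ | 1 < s.re} := by
  refine differentiableOn_halfPlane_of_forall_lt fun σ₁ hσ₁ => ?_
  refine (differentiableOn_partialStandardL_of_norm_sub_one_le
    (u := fun v => (2 ^ d - 1) * (v.1.residueCard : ℝ) ^ (-σ₁))
    (((summable_residueCard_rpow_neg hσ₁).subtype _).mul_left (2 ^ d - 1))
    (fun v s hs => ?_) (fun v s hs => ?_)).1
  · have hs' : σ₁ < s.re := hs
    have hq1 : (1 : ℝ) < v.1.residueCard := by exact_mod_cast v.1.one_lt_residueCard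
    have hq0 : (0 : ℝ) < v.1.residueCard := zero_lt_one.trans hq1
    have hx : ‖(v.1.residueCard : ℂ) ^ (-s)‖ ≤ (v.1.residueCard : ℝ) ^ (-s.re) := by
      rw [norm_natCast_cpow_of_pos (zero_lt_one.trans v.1.one_lt_residueCard), neg_re]
    have ht1 : (v.1.residueCard : ℝ) ^ (-s.re) ≤ 1 :=
      Real.rpow_le_one_of_one_le_of_nonpos hq1.le (by linarith)
    obtain ⟨h1, -⟩ := norm_eval_eulerPolynomial_sub_one_le zero_le_one hx
      (by rw [one_mul]; exact ht1) (β v.1) (hβ1 v.1 v.2)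
    refine h1.trans ?_
    rw [one_mul]
    have h2 : (2 : ℝ) ^ Multiset.card (β v.1) - 1 ≤ 2 ^ d - 1 := by
      have : (2 : ℝ) ^ Multiset.card (β v.1) ≤ 2 ^ d :=
        pow_le_pow_right₀ one_le_two (hd v.1 v.2)
      linarith
    have h3 : (v.1.residueCard : ℝ) ^ (-s.re) ≤ (v.1.residueCard : ℝ) ^ (-σ₁) :=
      Real.rpow_le_rpow_of_exponent_le hq1.le (by linarith)
    have h2n : (0 : ℝ) ≤ 2 ^ Multiset.card (β v.1) - 1 :=
      sub_nonneg.mpr (one_le_pow₀ (by norm_num))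
    calc (2 ^ Multiset.card (β v.1) - 1) * (v.1.residueCard : ℝ) ^ (-s.re)
        ≤ (2 ^ Multiset.card (β v.1) - 1) * (v.1.residueCard : ℝ) ^ (-σ₁) :=
          mul_le_mul_of_nonneg_left h3 h2n
      _ ≤ (2 ^ d - 1) * (v.1.residueCard : ℝ) ^ (-σ₁) :=
          mul_le_mul_of_nonneg_right h2 (Real.rpow_nonneg hq0.le _)
  · have hs' : σ₁ < s.re := hs
    have hq1 : (1 : ℝ) < v.1.residueCard := by exact_mod_cast v.1.one_lt_residueCard
    refine eval_eulerPolynomial_ne_zero_of_norm_mul_lt_one fun a ha => ?_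
    rw [norm_mul, norm_natCast_cpow_of_pos (zero_lt_one.trans v.1.one_lt_residueCard), neg_re]
    calc ‖a‖ * (v.1.residueCard : ℝ) ^ (-s.re)
        ≤ 1 * (v.1.residueCard : ℝ) ^ (-s.re) :=
          mul_le_mul_of_nonneg_right (hβ1 v.1 v.2 a ha) (Real.rpow_nonneg (by positivity) _)
      _ < 1 := by
          rw [one_mul]
          exact Real.rpow_lt_one_of_one_lt_of_neg hq1 (by linarith)

variable {V : Type*} [AddCommGroup V] [Module ℂ V] [TopologicalSpace V] [FiniteDimensional ℂ V]
  [IsModuleTopology ℂ V]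

/-- **Continuation of an Artin L-function to `re s > 0` from an entire continuation of one of
its partial Euler products.**  Let `ρ` be an Artin representation of `K`, `S` a finite set of
finite places, and `β` a family with `L_v(ρ, T) = ∏_{a ∈ β v} (1 - a T)`, `|a| ≤ 1`,
`card (β v) ≤ d` for `v ∉ S`, and suppose some entire `g` agrees with the partial Euler product
`L^S(s, β) = ∏'_{v ∉ S} L_v(ρ, q_v^{-s})⁻¹` on a right half-plane `re s > x₀`.  Then `L(s, ρ)`
(`artinLFunction`, the `tprod` over all finite places) agrees on `re s > 1` with a function
holomorphic on `re s > 0`, namely `(∏_{v ∈ S} L_v(ρ, q_v^{-s})⁻¹) · g(s)`: (i) `L^S(s, β)` is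
holomorphic on `re s > 1` (`differentiableOn_partialStandardL_of_norm_le_one`), so `g = L^S` there
(identity principle, `eqOn_halfPlane_of_eqOn_far_right`); (ii) the Euler product of `ρ` is
multipliable on `re s > 1` (`multipliable_artinLFunction_holds`) and splits off the finite set `S`
(`multipliable_compl_of_isUnit_prod`, `prod_mul_tprod_compl_of_multipliable`), the removed factors
being non-zero; (iii) each removed factor `L_v(ρ, q_v^{-s}) = ∏ (1 - μ q_v^{-s})`, `|μ| = 1`
(`ArtinRep.exists_eval_eulerFactorAt_eq_eval_eulerPolynomial`), is entire and non-zero on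
`re s > 0`.  This is the elementary half of "`L(s, π) = L(s, ρ)` and `L(s, π)` is entire"
(Tunnell 1981, p. 173) that survives when only the partial L-function of `π` is available; the
poles of the removed Artin factors lie on `re s = 0` (Deligne–Serre 1974, proof of Thm. 4.6,
(iv)). [cite: Tunnell1981, p. 173] [cite: DeligneSerreASENS1974, proof of Thm. 4.6 (iv)] -/
theorem exists_differentiableOn_re_pos_of_entire_partialL (ρ : ArtinRep K V)
    (S : Finset (HeightOneSpectrum (𝓞 K))) {β : SatakeFamily K} {d : ℕ}
    (hβ : ∀ v ∉ S, ∀ z : ℂ, (ρ.eulerFactorAt v).eval z = (eulerPolynomial (β v)).eval z)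
    (hβ1 : ∀ v ∉ S, ∀ a ∈ β v, ‖a‖ ≤ 1) (hd : ∀ v ∉ S, Multiset.card (β v) ≤ d)
    {g : ℂ → ℂ} (hg : Differentiable ℂ g) {x₀ : ℝ}
    (hgL : ∀ s : ℂ, x₀ < s.re → g s = partialStandardL (↑S) β s) :
    ∃ E : ℂ → ℂ, DifferentiableOn ℂ E {s : ℂ | 0 < s.re} ∧
      ∀ s : ℂ, 1 < s.re → E s = GaloisRepresentations.artinLFunction ρ s := by
  -- the removed Euler factors `E_v(s) = L_v(ρ, q_v^{-s})`
  set e : HeightOneSpectrum (𝓞 K) → ℂ → ℂ := fun v s =>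
    (ρ.eulerFactorAt v).eval ((v.residueCard : ℂ) ^ (-s)) with he
  have hed : ∀ v, Differentiable ℂ (e v) := fun v =>
    (ρ.eulerFactorAt v).differentiable.comp
      (differentiable_id.neg.const_cpow
        (Or.inl (Nat.cast_ne_zero.mpr (zero_lt_one.trans v.one_lt_residueCard).ne')))
  have hene : ∀ v (s : ℂ), 0 < s.re → e v s ≠ 0 := by
    intro v s hs
    obtain ⟨α, -, hnorm, hα⟩ := ρ.exists_eval_eulerFactorAt_eq_eval_eulerPolynomial v
    show (ρ.eulerFactorAt v).eval ((v.residueCard : ℂ) ^ (-s)) ≠ 0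
    rw [hα]
    refine eval_eulerPolynomial_ne_zero_of_norm_mul_lt_one fun a ha => ?_
    rw [norm_mul, norm_natCast_cpow_of_pos (zero_lt_one.trans v.one_lt_residueCard), neg_re,
      hnorm a ha, one_mul]
    exact Real.rpow_lt_one_of_one_lt_of_neg (by exact_mod_cast v.one_lt_residueCard)
      (by linarith)
  -- (i) `g = L^S(s, β)` on all of `re s > 1`
  have hLd : DifferentiableOn ℂ (partialStandardL (↑S) β) {s : ℂ | 1 < s.re} :=
    differentiableOn_partialStandardL_of_norm_le_one (fun v hv => hβ1 v hv) (fun v hv => hd v hv)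
  have hgL' : ∀ s : ℂ, 1 < s.re → g s = partialStandardL (↑S) β s :=
    eqOn_halfPlane_of_eqOn_far_right hg.differentiableOn hLd hgL
  refine ⟨fun s => (∏ v ∈ S, (e v s)⁻¹) * g s, ?_, fun s hs => ?_⟩
  · refine DifferentiableOn.mul (fun s hs => ?_) hg.differentiableOn
    have hs' : 0 < s.re := hs
    exact (DifferentiableAt.fun_finsetProd fun v _ =>
      (hed v s).inv (hene v s hs')).differentiableWithinAt
  · -- (ii) the splitting of the Euler product of `ρ` at `S` on `re s > 1`
    have hs0 : 0 < s.re := by linarith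
    set f : HeightOneSpectrum (𝓞 K) → ℂ := fun v => (e v s)⁻¹ with hf
    have hmult : Multipliable f := GaloisRepresentations.multipliable_artinLFunction_holds ρ hs
    have hunit : IsUnit (∏ v ∈ S, f v) :=
      isUnit_iff_ne_zero.mpr (Finset.prod_ne_zero_iff.mpr fun v _ => inv_ne_zero (hene v s hs0))
    have hsplit := prod_mul_tprod_compl_of_multipliable S
      (multipliable_compl_of_isUnit_prod S hmult hunit)
    have hL : GaloisRepresentations.artinLFunction ρ s = ∏' v, f v := rfl
    have hP : partialStandardL (↑S) β s =
        ∏' x : ↥((↑S : Set (HeightOneSpectrum (𝓞 K)))ᶜ), f x := by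
      unfold partialStandardL
      refine tprod_congr fun v => ?_
      show _ = (e v.1 s)⁻¹
      rw [he]
      dsimp only
      rw [hβ v.1 v.2]
    show (∏ v ∈ S, (e v s)⁻¹) * g s = GaloisRepresentations.artinLFunction ρ s
    rw [hgL' s hs, hP, hL, ← hsplit]

end AnalyticGlue

/-! ### The bridge from (FE) and (JL) -/

section Bridge

/-- **Tunnell's bridge from its two printed inputs.**  Assume (FE) Artin's functional equation
`Λ(1 - s, σ) = W Λ(s, σ^∨)` for framed Artin representations of every number field (the named
fact `artin_functional_equation`; Neukirch VII (12.6)) and (JL) the global Hecke theory of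
`GL(2)` in partial-L form: for every cuspidal automorphic representation `π` of `GL_2(𝔸_F)`
(`CuspidalAutomorphicRepData 2 F hcpt`), every finite set `S` of finite places and every Satake
family `α` of `π` off `S`, the partial Euler products `L^S(s, α)` and `L^S(s, α⁻¹)` — the
partial L-functions of `π` and of its contragredient `π̃` — continue to entire functions from
some right half-plane (Jacquet–Langlands 1970, §11, Thm. 11.1; Gelbart 1975, Thm. 6.18 (i) with
(6.43)–(6.44) and Thms. 6.15–6.16; Bump 1997, §3.5, (5.22)–(5.24), Thm. 3.5.6).  Then
`hasEntireContinuation_artinLFunction_of_isPiOfArtinRep` holds: if `π = π(σ)` almost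
everywhere then `L(s, σ)` is entire ("the L-series of `π` and `ρ` agree, and since cuspidal
representations have entire L-series, Artin's conjecture follows", Tunnell 1981, p. 173).
Proof: module docstring — the Euler factors of `σ` and `σ^∨` at the compatible places are the
Satake Euler factors of `α` and `α⁻¹`, so `L(s, σ)` and `L(s, σ^∨)` continue to `re s > 0`
(`exists_differentiableOn_re_pos_of_entire_partialL`), and (FE) finishes
(`ArtinRep.hasEntireContinuation_of_satisfiesFunctionalEquation`).  The irreducibility
hypothesis of the bridge is not used. [cite: Tunnell1981, p. 173]
[cite: JacquetLanglands1970, §11] [cite: Gelbart1975, Thm. 6.18]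
[cite: NeukirchANT1999, VII §12, Thm. (12.6)] -/
theorem hasEntireContinuation_artinLFunction_of_isPiOfArtinRep_of
    (hFE : ∀ (F : Type) [Field F] [NumberField F], artin_functional_equation (K := F))
    (hJL : ∀ {F : Type} [Field F] [NumberField F] (hcpt : isCompact_glFiniteIntegralLevel 2 F)
      (π : CuspidalAutomorphicRepData 2 F hcpt) (S : Finset (HeightOneSpectrum (𝓞 F)))
      (α : SatakeFamily F), (∀ v ∉ S, π.1.HasSatakeParamAt v (α v)) →
        (∃ g : ℂ → ℂ, Differentiable ℂ g ∧ ∃ x₀ : ℝ, ∀ s : ℂ, x₀ < s.re →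
          g s = partialStandardL ↑S α s) ∧
        (∃ g : ℂ → ℂ, Differentiable ℂ g ∧ ∃ x₀ : ℝ, ∀ s : ℂ, x₀ < s.re →
          g s = partialStandardL ↑S (dualFamily α) s)) :
    hasEntireContinuation_artinLFunction_of_isPiOfArtinRep := by
  intro F _ _ σ hcpt π _ hπ
  classical
  -- the finite exceptional set of `π = π(σ)`
  have hfin : {v : HeightOneSpectrum (𝓞 F) | ¬ FrobSatakeCompatibleAt σ π.1 v}.Finite :=
    Filter.eventually_cofinite.mp hπ
  set S : Finset (HeightOneSpectrum (𝓞 F)) := hfin.toFinset with hS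
  have hcomp : ∀ v ∉ S, FrobSatakeCompatibleAt σ π.1 v := fun v hv => by
    by_contra h
    exact hv (hfin.mem_toFinset.mpr h)
  -- the compatible Satake family off `S`
  let α : SatakeFamily F := fun v =>
    if h : FrobSatakeCompatibleAt σ π.1 v then h.choose else 0
  have hα : ∀ v ∉ S, π.1.HasSatakeParamAt v (α v) ∧ σ.IsUnramifiedAt v ∧
      σ.HasFrobCharpolyAt v (satakePolynomial (α v)) := fun v hv => by
    have h := hcomp v hv
    simp only [α, dif_pos h]
    exact h.choose_spec
  obtain ⟨⟨g, hg, x₀, hgL⟩, ⟨g', hg', x₀', hg'L⟩⟩ := hJL hcpt π S α fun v hv => (hα v hv).1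
  -- Galois side: Euler factors of `σ` and `σ^∨` off `S`
  have hd : ∀ v ∉ S, Multiset.card (α v) ≤ 2 := fun v hv => (hα v hv).1.card_eq.le
  have hβ : ∀ v ∉ S, ∀ z : ℂ,
      (σ.toArtinRep.eulerFactorAt v).eval z = (eulerPolynomial (α v)).eval z :=
    fun v hv z => by
      rw [eulerFactorAt_eq_eulerPolynomial_of_hasFrobCharpolyAt σ (hα v hv).2.1 (hα v hv).2.2]
  have hβ1 : ∀ v ∉ S, ∀ a ∈ α v, ‖a‖ ≤ 1 := fun v hv a ha =>
    (norm_eq_one_of_mem_of_hasFrobCharpolyAt σ (hα v hv).2.2 ha).le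
  have hβ' : ∀ v ∉ S, ∀ z : ℂ,
      ((FramedArtinRep.toArtinRep (GaloisRepresentations.FramedRep.dual σ)).eulerFactorAt v).eval
        z = (eulerPolynomial (dualFamily α v)).eval z :=
    fun v hv z => by
      rw [dual_eulerFactorAt_eq_eulerPolynomial_of_hasFrobCharpolyAt σ (hα v hv).2.1
        (hα v hv).2.2, dualFamily_apply]
  have hβ1' : ∀ v ∉ S, ∀ a ∈ dualFamily α v, ‖a‖ ≤ 1 := by
    intro v hv a ha
    rw [dualFamily_apply, Multiset.mem_map] at ha
    obtain ⟨b, hb, rfl⟩ := ha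
    rw [norm_inv, norm_eq_one_of_mem_of_hasFrobCharpolyAt σ (hα v hv).2.2 hb, inv_one]
  have hd' : ∀ v ∉ S, Multiset.card (dualFamily α v) ≤ 2 := fun v hv => by
    rw [dualFamily_apply, Multiset.card_map]
    exact hd v hv
  -- continuations to `re s > 0` and the functional equation
  obtain ⟨E, hE, hEL⟩ :=
    exists_differentiableOn_re_pos_of_entire_partialL σ.toArtinRep S hβ hβ1 hd hg hgL
  obtain ⟨E', hE', hE'L⟩ :=
    exists_differentiableOn_re_pos_of_entire_partialL
      (FramedArtinRep.toArtinRep (GaloisRepresentations.FramedRep.dual σ)) S hβ' hβ1' hd' hg' hg'L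
  exact GaloisRepresentations.ArtinRep.hasEntireContinuation_of_satisfiesFunctionalEquation
    (hFE F σ) le_rfl (by norm_num) ⟨E, hE, hEL⟩ ⟨E', hE', hE'L⟩

/-- **Langlands–Tunnell, Artin side, over a number field `F`, from the printed inputs with the
bridge unfolded**: the dihedral (Jacquet–Langlands §12), tetrahedral (Langlands 1980, §3) and
octahedral (Tunnell 1981) cases of the strong Artin conjecture, Artin's functional equation and
the global Hecke theory of `GL(2)` imply that every irreducible continuous `σ : Γ_F → GL_2(ℂ)`
with solvable image has entire Artin L-function
(`hasEntireContinuation_artinLFunction_of_isSolvable_of_cases` with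
`hasEntireContinuation_artinLFunction_of_isPiOfArtinRep_of`).
[cite: Tunnell1981, p. 173 and Theorem] [cite: Gelbart1997, Thm. 1.3, Remark (1)] -/
theorem hasEntireContinuation_artinLFunction_of_isSolvable_of_cases_of_FE_of_JL
    (hd : strongArtin_of_isDihedralType) (ht : strongArtin_of_isTetrahedralType)
    (ho : strongArtin_of_isOctahedralType)
    (hFE : ∀ (F : Type) [Field F] [NumberField F], artin_functional_equation (K := F))
    (hJL : ∀ {F : Type} [Field F] [NumberField F] (hcpt : isCompact_glFiniteIntegralLevel 2 F)
      (π : CuspidalAutomorphicRepData 2 F hcpt) (S : Finset (HeightOneSpectrum (𝓞 F)))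
      (α : SatakeFamily F), (∀ v ∉ S, π.1.HasSatakeParamAt v (α v)) →
        (∃ g : ℂ → ℂ, Differentiable ℂ g ∧ ∃ x₀ : ℝ, ∀ s : ℂ, x₀ < s.re →
          g s = partialStandardL ↑S α s) ∧
        (∃ g : ℂ → ℂ, Differentiable ℂ g ∧ ∃ x₀ : ℝ, ∀ s : ℂ, x₀ < s.re →
          g s = partialStandardL ↑S (dualFamily α) s))
    {F : Type} [Field F] [NumberField F] (σ : FramedArtinRep F 2)
    (hirr : σ.toGaloisRep.IsIrreducible) (hsolv : IsSolvable σ.toMonoidHom.range) :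
    GaloisRepresentations.LFunction.HasEntireContinuation
      (GaloisRepresentations.artinLFunction σ.toArtinRep) :=
  hasEntireContinuation_artinLFunction_of_isSolvable_of_cases hd ht ho
    (hasEntireContinuation_artinLFunction_of_isPiOfArtinRep_of hFE hJL) σ hirr hsolv

/-- **The target over `ℚ` from the printed inputs with the bridge unfolded**: the named fact
`langlands_tunnell_hasEntireContinuation` of `Automorphic/ArtinLFunctions` follows from the three
cases of the strong Artin conjecture, Artin's functional equation and the global Hecke theory of
`GL(2)` (`langlands_tunnell_hasEntireContinuation_of_cases` with
`hasEntireContinuation_artinLFunction_of_isPiOfArtinRep_of`).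
[cite: Tunnell1981, p. 173 and Theorem] [cite: LanglandsBaseChange1980, §3] -/
theorem langlands_tunnell_hasEntireContinuation_of_cases_of_FE_of_JL
    (hd : strongArtin_of_isDihedralType) (ht : strongArtin_of_isTetrahedralType)
    (ho : strongArtin_of_isOctahedralType)
    (hFE : ∀ (F : Type) [Field F] [NumberField F], artin_functional_equation (K := F))
    (hJL : ∀ {F : Type} [Field F] [NumberField F] (hcpt : isCompact_glFiniteIntegralLevel 2 F)
      (π : CuspidalAutomorphicRepData 2 F hcpt) (S : Finset (HeightOneSpectrum (𝓞 F)))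
      (α : SatakeFamily F), (∀ v ∉ S, π.1.HasSatakeParamAt v (α v)) →
        (∃ g : ℂ → ℂ, Differentiable ℂ g ∧ ∃ x₀ : ℝ, ∀ s : ℂ, x₀ < s.re →
          g s = partialStandardL ↑S α s) ∧
        (∃ g : ℂ → ℂ, Differentiable ℂ g ∧ ∃ x₀ : ℝ, ∀ s : ℂ, x₀ < s.re →
          g s = partialStandardL ↑S (dualFamily α) s)) :
    langlands_tunnell_hasEntireContinuation :=
  langlands_tunnell_hasEntireContinuation_of_cases hd ht ho
    (hasEntireContinuation_artinLFunction_of_isPiOfArtinRep_of hFE hJL)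

end Bridge

end Literature.NumberTheory.Automorphic

end
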